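import Summits.BirchSwinnertonDyer.BirchSwinnertonDyer.Theorems.AdditiveKolyvaginRoadShaEigenParity
import Summits.BirchSwinnertonDyer.BirchSwinnertonDyer.Theorems.AdditiveKolyvaginRoadLevelSystemsSelmerBottom
import Summits.BirchSwinnertonDyer.BirchSwinnertonDyer.Theorems.AdditiveKolyvaginRoadEigen
import Literature.NumberTheory.EllipticCurves.MordellWeilTheoremProofs
import Literature.NumberTheory.EllipticCurves.BSDRankZeroDensityProofs
import Summits.BirchSwinnertonDyer.BirchSwinnertonDyer.Theorems.KolyvaginRoadThreeMethod2ParityRank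
import Summits.BirchSwinnertonDyer.BirchSwinnertonDyer.Theses.AdditiveKolyvaginRoad
import HarnessLib

/-!
# Route `AdditiveKolyvaginRoad`, crux `LevelKolyvaginSystemsAdditive` (item stmt-BirchSwinnertonDyer-21396, KS′):
# THE p-SELMER PARITY BY SIGN — at a ♯ frame `dim_𝔽_p Sel_∅^{−w(E)}` is ODD and `dim_𝔽_p Sel_∅^{w(E)}` is EVEN,
# from the route's published inputs (PUB: Gross–Zagier, Kolyvagin, modularity; DUAL.1: levelwise Cassels–Tate)
# (cell `pub/bsd-wall`, width seat `bsd-wall-akr-p2x-w3` g4; `--supports stmt-BirchSwinnertonDyer-21396`, helper; sequel of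
# `AdditiveKolyvaginRoadShaEigenParity`)

WHY. The carrier reads `Sel_p(E/K)` through the eigenspaces `SelQP W K p c ∅ μ` of complex conjugation; the tree had only the
TOTAL parity (`odd_finrank_selQP_empty_of_published`, part 6: `dim Sel_∅⁺ + dim Sel_∅⁻` odd). The parity BY SIGN is the E-side
input of every parity-forced step: the transfer lines' (A1) stub (w2 g3's `…LagrangianSwitchAtP.eq_kummer_of_isotropic_of_even_iff`
takes `#Sel = p^a`, `#Sel' = p^b`, `a ≡ b (2)` as ABSTRACT inputs; over `ℚ` the `p`-Selmer group of `E` is the `+`-part, `p` odd), and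
Kolyvagin's structure theorem (Kolyvagin 1991 Thm. 4 ∕ W. Zhang 2014 Thm. 11.2: `r_p^{ε}` odd, `r_p^{−ε}` even). Here it is PROVED
from the route's displayed inputs: `Sel_∅^μ ↠ Ш(E/K)[p]^μ` with kernel `Sel_∅^μ ∩ δ(E(K))` (Kummer sequence, AEC X.4.2), the image
`δ(E(K)) ≅ E(K)/p` is ONE line sitting in the `−w(E)`-eigenspace (rank one + `c y_K = −w(E) y_K` mod torsion, the PROVED reflection
fact), and `Ш(E/K)[p]^{±}` are even-dimensional (`AdditiveKolyvaginRoadShaEigenParity`, McCallum's equivariant Cassels–Tate).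

WHAT (namespace `…Theorems.AdditiveKoly`).
* §1 `isOfFinAddOrder_map_sub_zsmul_of_rankOne` — if `rank_ℤ E(K) = 1`, `P₀ ∈ E(K)` has infinite order and `c P₀ − s P₀` is torsion,
  then `c P − s P` is torsion for EVERY `P ∈ E(K)` (`P₀, P` are `ℤ`-dependent: Mordell–Weil `module_finite_point_holds` +
  `LinearIndependent.pair_iff`).
* §2 `natCard_selQP_empty_eq_of_sign` — for `E = W/ℚ`, `K` imaginary quadratic, `p` odd, `c ≠ 1`, `ρ̄_{E,p}` irreducible,
  `rank_ℤ E(K) = 1`, `Ш(E/K)` finite, `casselsTate_levelInputs K`, and a non-torsion `P₀ ∈ E(K)` with `c P₀ − sgnP μ₀ • P₀` torsion: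
  `#Sel_∅^μ = (p if μ = μ₀ else 1) · p^{2m}` — the count `#Sel_∅^μ = #(Sel_∅^μ ∩ δ(E(K))) · #Ш[p]^{sgnP μ}` (restriction of
  `H¹(K,E[p]) → H¹(K,E)` to `Sel_∅^μ`: image = the `sgnP μ`-eigen-part of `Ш[p]` by lifting and symmetrising, kernel =
  `Sel_∅^μ ∩ δ(E(K))`
  by exactness `mem_range_kummerMapTorsion_of_torsionH1ToH1_eq_zero`), with `δ(E(K)) ⊆ Sel_∅^{μ₀}` (§1 +
  `kummerMapTorsion_mem_selQP_empty_of_isOfFinAddOrder`), `#δ(E(K)) = #E(K)/p = p` (`kummerMapTorsion_ker`, `natCard_quotient_range_zsmul`,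
  `E(K)[p] = 0`), opposite eigenspaces meeting in `0`; `finrank_selQP_empty_odd_and_even`: `dim Sel_∅^{μ₀}` ODD, `dim Sel_∅^{¬μ₀}` EVEN.
* §3 **`odd_finrank_selQP_empty_sign_and_even_of_published`** — at a ♯ frame of the crux (`p ≥ 5`, `ρ̄` onto, `r_an = 1`, `K` imaginary
  quadratic Heegner for `N_E`, `L(E^{d_K},1) ≠ 0`, `4N ∣ β² − d_K`, `c ≠ 1`), granted `PublishedInputsAdditiveKoly` and
  `PublishedDualityInputsAdditiveKoly`: `Odd (finrank (SelQP W K p c ∅ μ₀)) ∧ Even (finrank (SelQP W K p c ∅ (!μ₀)))` with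
  `μ₀ := (w(E) = −1)`, i.e. the eigenspace carrying `c(1) = δ(y_K)` (`kolyvaginClass_one_mem_selQP_empty`) is the odd one. Inputs as in
  akr-p1's `oddSelmerRankAdditive_of_levelInputs`: `y_K` non-torsion (Gross–Zagier + modularity), Kolyvagin (rank one, `Ш` finite),
  the reflection fact `heegnerPoint_conj_add_rootNumber_smul_holds` (Darmon Prop. 3.11), DUAL.1.

HONEST FRAMING: theorems only; 0 definitions, 0 named facts, 0 `sorry`; CONDITIONAL on PUB ∕ DUAL.1 (published, by name); E-side;
closes nothing. For `r_an(E) = 1` one has `w(E) = −1`, so the ODD eigenspace is `Sel_∅⁺ = Sel_p(E/K)^{c = 1}` (the tree keeps `w(E)`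
symbolic, as `…LevelSystemsSelmerBottom` does). BSD is not proved by any of this.

References: [cite: Kolyvagin1991MathAnn, §2 Thm. 4] [cite: WZhang2014, Thm. 9.2, Thm. 11.2 (i)] [cite: GrossLMS1991, §5 (5.1), Prop. 5.3,
§10 (Prop. 2.3)] [cite: McCallumLMS1991, §5, Thm. 5.4, Thm. 5.8] [cite: Darmon2004, Prop. 3.11] [cite: SilvermanAEC2009, §VIII.2,
Thm. X.4.2(a), VIII.6] [cite: MilneADT2006, Ch. I §6, Thm. 6.13(a)].
-/

-- single-conjunct summit: `Summit.BirchSwinnertonDyer.BirchSwinnertonDyer.…` repeats the name by design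
set_option linter.dupNamespace false

noncomputable section

open scoped Classical AddSubgroup

namespace Summit.BirchSwinnertonDyer.BirchSwinnertonDyer.Theorems.AdditiveKoly

open WeierstrassCurve NumberField IsDedekindDomain Field Literature.NumberTheory.EllipticCurves
  Literature.NumberTheory.EllipticCurves.ModularForms Literature.NumberTheory.EllipticCurves.Rank1Residual
  Literature.NumberTheory.GaloisRepresentations Literature.NumberTheory.GaloisCohomology Module

/-! ## §1 The conjugation sign on `E(K)` in rank one -/

section RankOne

variable {K : Type} [Field K] [NumberField K] (W : WeierstrassCurve ℚ) [W.IsElliptic] (c : K ≃ₐ[ℚ] K)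

/-- **In rank one the conjugation sign of ONE non-torsion point is the sign of EVERY point.** For `E = W/ℚ` over a number field
`K` with `rank_ℤ E(K) = 1`, `σ ∈ Aut(K/ℚ)`, `s ∈ ℤ`, and `P₀ ∈ E(K)` of infinite order with `σ P₀ − s P₀` torsion:
`σ P − s P` is torsion for every `P ∈ E(K)` (`P₀, P` are `ℤ`-linearly dependent by Mordell–Weil, `b P = −a P₀` with `b ≠ 0`,
and `σ` is additive).
[cite: SilvermanAEC2009, VIII.6 (Mordell–Weil)] [cite: GrossLMS1991, Prop. 5.3] -/
theorem isOfFinAddOrder_map_sub_zsmul_of_rankOne (hrank : (W.baseChange K).mordellWeilRank = 1) (s : ℤ)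
    {P₀ : (W.baseChange K).toAffine.Point} (hP₀ : ¬ IsOfFinAddOrder P₀)
    (hP₀c : IsOfFinAddOrder (Affine.Point.map (W' := W) (c : K →ₐ[ℚ] K) P₀ - s • P₀))
    (P : (W.baseChange K).toAffine.Point) :
    IsOfFinAddOrder (Affine.Point.map (W' := W) (c : K →ₐ[ℚ] K) P - s • P) := by
  haveI : Module.Finite ℤ (W.baseChange K).toAffine.Point := (W.baseChange K).module_finite_point_holds
  -- `P₀, P` are linearly dependent over `ℤ` (`rank_ℤ E(K) = 1`)
  have hdep : ¬ LinearIndependent ℤ ![P₀, P] := by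
    intro h
    have h2 := h.fintype_card_le_finrank
    rw [Fintype.card_fin] at h2
    change 2 ≤ (W.baseChange K).mordellWeilRank at h2
    omega
  rw [LinearIndependent.pair_iff] at hdep
  push Not at hdep
  obtain ⟨a, b, hab, hne⟩ := hdep
  -- `b ≠ 0` since `P₀` has infinite order
  have hb : b ≠ 0 := by
    intro hb0
    rw [hb0, zero_smul, add_zero] at hab
    have ha : a ≠ 0 := fun ha0 ↦ hne ha0 hb0
    exact hP₀ (isOfFinAddOrder_iff_zsmul_eq_zero.mpr ⟨a, ha, hab⟩)
  -- `b • P = -a • P₀`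
  have hbP : b • P = -a • P₀ := by
    rw [neg_smul, eq_neg_iff_add_eq_zero, add_comm]
    exact hab
  -- `b • (cP - sP) = -a • (cP₀ - sP₀)` has finite order
  have hfin : IsOfFinAddOrder (b • (Affine.Point.map (W' := W) (c : K →ₐ[ℚ] K) P - s • P)) := by
    have h : b • (Affine.Point.map (W' := W) (c : K →ₐ[ℚ] K) P - s • P) =
        -a • (Affine.Point.map (W' := W) (c : K →ₐ[ℚ] K) P₀ - s • P₀) := by
      rw [zsmul_sub, ← map_zsmul, smul_comm, hbP, map_zsmul, zsmul_sub, smul_comm]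
    rw [h]
    exact hP₀c.zsmul
  obtain ⟨n, hn, hnb⟩ := isOfFinAddOrder_iff_zsmul_eq_zero.mp hfin
  exact isOfFinAddOrder_iff_zsmul_eq_zero.mpr ⟨n * b, mul_ne_zero hn hb, by rw [mul_zsmul]; exact hnb⟩

end RankOne

/-! ## §2 The signed count `#Sel_∅^μ = #(Sel_∅^μ ∩ δ(E(K))) · #Ш(E/K)[p]^μ` and the two parities -/

section Core

variable {K : Type} [Field K] [NumberField K] (W : WeierstrassCurve ℚ) [W.IsElliptic] [W.IsGloballyMinimal]
  (p : ℕ) [hp : Fact p.Prime] (c : K ≃ₐ[ℚ] K) [Module (ZMod p) (Vp W K p)]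

set_option maxHeartbeats 400000 in
/-- **THE SIGNED COUNT `#Sel_∅^μ = #(Sel_∅^μ ∩ δ(E(K))) · #Ш(E/K)[p]^{sgnP μ}`, EVALUATED.** For `E = W/ℚ`, `K` imaginary
quadratic, `p` odd, `c ∈ Aut(K/ℚ)`, `c ≠ 1`, `c² = 1`, `ρ̄_{E,p}` irreducible (`E(K)[p] = 0`), `rank_ℤ E(K) = 1`, `Ш(E/K)` finite, the
levelwise Cassels–Tate inputs, and a non-torsion `P₀ ∈ E(K)` with `c P₀ − sgnP μ₀ • P₀` torsion: `#Sel_∅^μ = p^{2m+1}` if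
`μ = μ₀` and `= p^{2m}` otherwise. Road: restrict `ρ : H¹(K, E[p]) → H¹(K, E)` to `Sel_∅^μ`; its image is the `sgnP μ`-eigen-part
of `Ш[p]` (⊆ by
`torsionH1ToH1_conjAct`; ⊇ by lifting to `Sel^{(p)}` — AEC X.4.2(a) — and symmetrising, `exists_eigen_add_eigen_selmerGroup`), of order
`p^{2m}` (`natCard_sha_torsion_eigen_eq_pow_two_mul`); its kernel is `Sel_∅^μ ∩ δ(E(K))` (exactness of the Kummer sequence), and
`δ(E(K)) ≅ E(K)/pE(K)` has order `p` (rank one, `E(K)[p] = 0`) and lies in `Sel_∅^{μ₀}` (§1 +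
`kummerMapTorsion_mem_selQP_empty_of_isOfFinAddOrder`), while `Sel_∅^{μ} ∩ Sel_∅^{μ₀} = 0` for `μ ≠ μ₀` (`2` and `p` coprime).
[cite: SilvermanAEC2009, §VIII.2 and Thm. X.4.2(a)]
[cite: GrossLMS1991, §5 (5.1)] [cite: McCallumLMS1991, §5, Thm. 5.4, Thm. 5.8] [cite: Kolyvagin1991MathAnn, §2 Thm. 4] -/
theorem natCard_selQP_empty_eq_of_sign (hCT : casselsTate_levelInputs K) (hK : IsImaginaryQuadratic K) (hp2 : p ≠ 2)
    (hc1 : c ≠ 1) (hcc : c * c = 1) (hirr : W.HasIrreducibleModPGaloisRep p)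
    (hrank : (W.baseChange K).mordellWeilRank = 1) (hSha : Finite (W.baseChange K).sha)
    (μ₀ : Bool) {P₀ : (W.baseChange K).toAffine.Point} (hP₀ : ¬ IsOfFinAddOrder P₀)
    (hP₀c : IsOfFinAddOrder (Affine.Point.map (W' := W) (c : K →ₐ[ℚ] K) P₀ - sgnP μ₀ • P₀)) (μ : Bool) :
    ∃ m : ℕ, Nat.card (SelQP W K p c ∅ μ) = (if μ = μ₀ then p else 1) * p ^ (2 * m) := by
  have hpp : p.Prime := hp.out
  set V := W.baseChange K with hV
  have hn : (p ^ 1 : ℕ) ≠ 0 := pow_ne_zero 1 hpp.ne_zero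
  have hnZ : ((p ^ 1 : ℕ) : ℤ) ≠ 0 := Int.natCast_ne_zero.mpr hn
  have hp1 : ((p ^ 1 : ℕ) : ℤ) = (p : ℤ) := by rw [pow_one]
  set τ := conjAct W c ((p ^ 1 : ℕ) : ℤ) with hτdef
  set τ' := (isLiftOfAut_liftAut c).conjH1Points W with hτ'
  set ρ := torsionH1ToH1 V ((p ^ 1 : ℕ) : ℤ) with hρ
  have hρc : ∀ z, ρ (τ z) = τ' (ρ z) := fun z ↦ torsionH1ToH1_conjAct W c _ z
  -- the Kummer map `δ : E(K) → H¹(K, E[p])` and its image: `δ(E(K)) ⊆ Sel_∅^{μ₀}`, `#δ(E(K)) = p`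
  set hdiv := V.zsmul_geomPoints_surjective_of_charZero (n := ((p ^ 1 : ℕ) : ℤ))
    (by exact_mod_cast pow_ne_zero 1 hpp.ne_zero) with hhdiv
  set κ := kummerMapTorsion V ((p ^ 1 : ℕ) : ℤ) hdiv with hκ
  have hκμ₀ : ∀ P, κ P ∈ SelQP W K p c ∅ μ₀ := fun P ↦
    kummerMapTorsion_mem_selQP_empty_of_isOfFinAddOrder W p K hirr hK c μ₀ P
      (isOfFinAddOrder_map_sub_zsmul_of_rankOne W c hrank (sgnP μ₀) hP₀ hP₀c P)
  have hbot : AddSubgroup.torsionBy V.toAffine.Point ((p ^ 1 : ℕ) : ℤ) = ⊥ := by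
    rw [hp1]; exact torsionBy_eq_bot_of_isImaginaryQuadratic_of_hasIrreducibleModPGaloisRep W K hK hpp hirr
  have hκcard : Nat.card κ.range = p := by
    rw [← Nat.card_congr (QuotientAddGroup.quotientKerEquivRange κ).toEquiv, hκ, kummerMapTorsion_ker,
      V.natCard_quotient_range_zsmul hn, hrank, hbot, AddSubgroup.card_bot, pow_one, pow_one, mul_one]
  -- exactness at `H¹(K, E[p])`: `ker ρ = δ(E(K))`
  have hkerρ : ∀ x, ρ x = 0 ↔ x ∈ κ.range := fun x ↦
    ⟨fun hx ↦ mem_range_kummerMapTorsion_of_torsionH1ToH1_eq_zero V _ hdiv x hx,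
      fun ⟨P, hP⟩ ↦ by rw [← hP]; exact torsionH1ToH1_kummerMapTorsion V _ hdiv P⟩
  -- the subgroup `S = Sel_∅^μ` and the restriction of `ρ` to it
  set S : Submodule (ZMod p) (Vp W K p) := SelQP W K p c ∅ μ with hSdef
  have memS : ∀ x, x ∈ S ↔ τ x = sgnP μ • x ∧ x ∈ selmerGroup V ((p ^ 1 : ℕ) : ℤ) := fun x ↦
    mem_selQP_empty_iff W K p c μ x
  haveI : Finite (selmerGroup V ((p ^ 1 : ℕ) : ℤ)) := V.finite_selmerGroup_holds hnZ
  haveI hSfin : Finite S := by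
    refine Finite.of_injective (fun x : S ↦ (⟨x.1, ((memS x.1).mp x.2).2⟩ : selmerGroup V ((p ^ 1 : ℕ) : ℤ))) ?_
    intro a b h
    exact Subtype.ext (congrArg Subtype.val h :)
  set ρS : S →+ V.galH1 := ρ.comp S.toAddSubgroup.subtype with hρS
  have hρS : ∀ x : S, ρS x = ρ x.1 := fun _ ↦ rfl
  -- `#S = #ker ρS · #range ρS`
  have hcardS : Nat.card S = Nat.card ρS.ker * Nat.card ρS.range := by
    rw [← Nat.card_congr (QuotientAddGroup.quotientKerEquivRange ρS).toEquiv, mul_comm]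
    exact AddSubgroup.card_eq_card_quotient_mul_card_addSubgroup ρS.ker
  -- the range: the `sgnP μ`-eigen-part of `Ш[p]`
  have hrange : Nat.card ρS.range = Nat.card {y : V.galH1 // y ∈ V.sha ∧ (p : ℤ) • y = 0 ∧ τ' y = sgnP μ • y} := by
    refine Nat.card_congr (Equiv.subtypeEquivRight fun y ↦ ⟨?_, ?_⟩)
    · rintro ⟨x, rfl⟩
      obtain ⟨hxτ, hxSel⟩ := (memS x.1).mp x.2
      have hmem : ρ x.1 ∈ (selmerGroup V ((p ^ 1 : ℕ) : ℤ)).map ρ := AddSubgroup.mem_map_of_mem _ hxSel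
      rw [WeierstrassCurve.map_torsionH1ToH1_selmerGroup_holds V hnZ] at hmem
      obtain ⟨hsha, htor⟩ := AddSubgroup.mem_inf.mp hmem
      refine ⟨hsha, ?_, ?_⟩
      · have h := AddSubgroup.torsionBy.nsmul_iff.mp htor
        simp only [pow_one] at h
        rwa [← natCast_zsmul] at h
      · rw [hρS, ← hρc, hxτ, map_zsmul]
    · rintro ⟨hsha, hpy, hτy⟩
      -- lift to `Sel^{(p)}`, split into eigen-classes, keep the `sgnP μ`-part
      obtain ⟨t, ht, hty⟩ := exists_mem_selmerGroup_torsionH1ToH1_eq W hn hsha (by rw [hp1]; exact hpy)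
      obtain ⟨t₁, ht₁, t₂, ht₂, htt, hct₁, hct₂⟩ :=
        exists_eigen_add_eigen_selmerGroup W hK c hcc ((hpp.odd_of_ne_two hp2).pow (n := 1)) ht
      have hcop : (2 : ℕ).Coprime p := Nat.coprime_two_left.mpr (hpp.odd_of_ne_two hp2)
      have hy12 : y = ρ t₁ + ρ t₂ := by rw [← map_add, ← htt, hty]
      have hτy' : τ' y = ρ t₁ - ρ t₂ := by rw [hy12, map_add, ← hρc, ← hρc, hct₁, hct₂, map_neg, sub_eq_add_neg]
      have hptor : ∀ {z}, z ∈ selmerGroup V ((p ^ 1 : ℕ) : ℤ) → p • ρ z = 0 := fun {z} hz ↦ by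
        have hmem : ρ z ∈ (selmerGroup V ((p ^ 1 : ℕ) : ℤ)).map ρ := AddSubgroup.mem_map_of_mem _ hz
        rw [WeierstrassCurve.map_torsionH1ToH1_selmerGroup_holds V hnZ] at hmem
        have h := AddSubgroup.torsionBy.nsmul_iff.mp (AddSubgroup.mem_inf.mp hmem).2
        simpa only [pow_one] using h
      cases μ with
      | true =>
        -- `τ' y = y`: `2 ρ t₂ = 0`, so `ρ t₂ = 0` and `y = ρ t₁`, `t₁ ∈ S`
        have h2 : 2 • ρ t₂ = 0 := by
          have h : ρ t₁ - ρ t₂ = ρ t₁ + ρ t₂ := by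
            rw [← hτy', hτy, hy12, show sgnP true = 1 from rfl, one_zsmul]
          have h' : -ρ t₂ = ρ t₂ := by
            rw [sub_eq_add_neg] at h
            exact add_left_cancel h
          rw [two_nsmul]
          nth_rw 1 [← h']
          exact neg_add_cancel _
        have ht₂0 : ρ t₂ = 0 := eq_zero_of_nsmul_eq_zero_of_coprime hcop h2 (hptor ht₂)
        refine ⟨⟨t₁, (memS t₁).mpr ⟨by rw [hct₁, show sgnP true = 1 from rfl, one_zsmul], ht₁⟩⟩, ?_⟩
        rw [hρS, hy12, ht₂0, add_zero]
      | false =>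
        -- `τ' y = -y`: `2 ρ t₁ = 0`, so `ρ t₁ = 0` and `y = ρ t₂`, `t₂ ∈ S`
        have h2 : 2 • ρ t₁ = 0 := by
          have h : ρ t₁ - ρ t₂ = -(ρ t₁ + ρ t₂) := by
            rw [← hτy', hτy, hy12, show sgnP false = -1 from rfl, neg_one_zsmul]
          have h' : ρ t₁ = -ρ t₁ := by
            have h'' := sub_eq_iff_eq_add.mp h
            rwa [neg_add, add_assoc, neg_add_cancel, add_zero] at h''
          rw [two_nsmul]
          nth_rw 2 [h']
          exact add_neg_cancel _
        have ht₁0 : ρ t₁ = 0 := eq_zero_of_nsmul_eq_zero_of_coprime hcop h2 (hptor ht₁)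
        refine ⟨⟨t₂, (memS t₂).mpr ⟨by rw [hct₂, show sgnP false = -1 from rfl, neg_one_zsmul], ht₂⟩⟩, ?_⟩
        rw [hρS, hy12, ht₁0, zero_add]
  have hsμ : sgnP μ = 1 ∨ sgnP μ = -1 := by cases μ; exacts [Or.inr rfl, Or.inl rfl]
  obtain ⟨m, hm⟩ := natCard_sha_torsion_eigen_eq_pow_two_mul W hCT hK p hp2 c hc1 hcc hSha (sgnP μ) hsμ
  -- the kernel: `S ∩ δ(E(K))`
  have hker : Nat.card ρS.ker = if μ = μ₀ then p else 1 := by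
    by_cases hμ : μ = μ₀
    · -- `δ(E(K)) ⊆ S`, so `ker ρS ≃ δ(E(K))`
      subst hμ
      rw [if_pos rfl]
      refine (Nat.card_congr ?_).trans hκcard
      exact
        { toFun := fun x ↦ ⟨x.1.1, (hkerρ _).mp (by have := x.2; rwa [AddMonoidHom.mem_ker, hρS] at this)⟩
          invFun := fun y ↦ ⟨⟨y.1, by obtain ⟨P, hP⟩ := y.2; rw [← hP]; exact hκμ₀ P⟩,
            by rw [AddMonoidHom.mem_ker, hρS]; exact (hkerρ _).mpr y.2⟩
          left_inv := fun x ↦ rfl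
          right_inv := fun y ↦ rfl }
    · -- `S ∩ δ(E(K)) ⊆ Sel^μ ∩ Sel^{μ₀} = 0`
      rw [if_neg hμ, Nat.card_eq_one_iff_unique]
      refine ⟨⟨fun a b ↦ ?_⟩, ⟨0⟩⟩
      suffices h0 : ∀ x : ρS.ker, x = 0 by rw [h0 a, h0 b]
      intro x
      have hx0 : ρ x.1.1 = 0 := by have := x.2; rwa [AddMonoidHom.mem_ker, hρS] at this
      obtain ⟨P, hP⟩ := (hkerρ _).mp hx0
      have h1 : τ x.1.1 = sgnP μ • x.1.1 := ((memS _).mp x.1.2).1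
      have h2 : τ x.1.1 = sgnP μ₀ • x.1.1 := by rw [← hP]; exact ((mem_selQP_empty_iff W K p c μ₀ _).mp (hκμ₀ P)).1
      have hxx : x.1.1 + x.1.1 = 0 := by
        have h := h1.symm.trans h2
        revert hμ h
        cases μ <;> cases μ₀ <;> intro hμ h
        · exact absurd rfl hμ
        · rw [show sgnP false = -1 from rfl, show sgnP true = 1 from rfl, neg_one_zsmul, one_zsmul] at h
          nth_rw 1 [← h]
          exact neg_add_cancel _
        · rw [show sgnP false = -1 from rfl, show sgnP true = 1 from rfl, neg_one_zsmul, one_zsmul] at h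
          nth_rw 2 [h]
          exact add_neg_cancel _
        · exact absurd rfl hμ
      have h2x : 2 • x.1.1 = 0 := by rw [two_nsmul]; exact hxx
      have hpx : p • x.1.1 = 0 := by
        have h := prime_smul_eq_zero W K p x.1.1
        rwa [natCast_zsmul] at h
      have hcop : (2 : ℕ).Coprime p := Nat.coprime_two_left.mpr (hpp.odd_of_ne_two hp2)
      exact Subtype.ext (Subtype.ext (eq_zero_of_nsmul_eq_zero_of_coprime hcop h2x hpx))
  refine ⟨m, ?_⟩
  rw [show Nat.card (SelQP W K p c ∅ μ) = Nat.card S from rfl, hcardS, hker, hrange, hm]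

/-- **THE PARITY BY SIGN**: under the hypotheses of `natCard_selQP_empty_eq_of_sign`, `dim_𝔽_p Sel_∅^{μ₀}` is ODD and
`dim_𝔽_p Sel_∅^{¬μ₀}` is EVEN (`p ^ dim = #`, `pow_finrank_eq_natCard`). [cite: Kolyvagin1991MathAnn, §2 Thm. 4]
[cite: WZhang2014, Thm. 11.2 (i)] [cite: GrossLMS1991, §5 (5.1), §10] -/
theorem finrank_selQP_empty_odd_and_even (hCT : casselsTate_levelInputs K) (hK : IsImaginaryQuadratic K) (hp2 : p ≠ 2)
    (hc1 : c ≠ 1) (hcc : c * c = 1) (hirr : W.HasIrreducibleModPGaloisRep p)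
    (hrank : (W.baseChange K).mordellWeilRank = 1) (hSha : Finite (W.baseChange K).sha)
    (μ₀ : Bool) {P₀ : (W.baseChange K).toAffine.Point} (hP₀ : ¬ IsOfFinAddOrder P₀)
    (hP₀c : IsOfFinAddOrder (Affine.Point.map (W' := W) (c : K →ₐ[ℚ] K) P₀ - sgnP μ₀ • P₀)) :
    Odd (finrank (ZMod p) (SelQP W K p c ∅ μ₀)) ∧ Even (finrank (ZMod p) (SelQP W K p c ∅ (!μ₀))) := by
  have hpp : p.Prime := hp.out
  have key := fun μ ↦ natCard_selQP_empty_eq_of_sign W p c hCT hK hp2 hc1 hcc hirr hrank hSha μ₀ hP₀ hP₀c μ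
  have hnZ : ((p ^ 1 : ℕ) : ℤ) ≠ 0 := Int.natCast_ne_zero.mpr (pow_ne_zero 1 hpp.ne_zero)
  haveI : Finite (selmerGroup (W.baseChange K) ((p ^ 1 : ℕ) : ℤ)) := (W.baseChange K).finite_selmerGroup_holds hnZ
  have hfin : ∀ μ, Finite (SelQP W K p c ∅ μ) := fun μ ↦ by
    refine Finite.of_injective (fun x : SelQP W K p c ∅ μ ↦
      (⟨x.1, ((mem_selQP_empty_iff W K p c μ x.1).mp x.2).2⟩ : selmerGroup (W.baseChange K) ((p ^ 1 : ℕ) : ℤ))) ?_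
    intro a b h
    exact Subtype.ext (congrArg Subtype.val h :)
  constructor
  · obtain ⟨m, hm⟩ := key μ₀
    haveI := hfin μ₀
    rw [if_pos rfl, ← pow_succ', ← Literature.NumberTheory.EllipticCurves.pow_finrank_eq_natCard (p := p)
      (SelQP W K p c ∅ μ₀)] at hm
    exact ⟨m, by rw [Nat.pow_right_injective hpp.two_le hm]⟩
  · obtain ⟨m, hm⟩ := key (!μ₀)
    haveI := hfin (!μ₀)
    rw [if_neg (by cases μ₀ <;> decide), one_mul,
      ← Literature.NumberTheory.EllipticCurves.pow_finrank_eq_natCard (p := p) (SelQP W K p c ∅ (!μ₀))] at hm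
    exact ⟨m, by rw [Nat.pow_right_injective hpp.two_le hm]; ring⟩

end Core

/-! ## §3 At a ♯ frame, from the published inputs: `dim Sel_∅^{−w(E)}` is ODD and `dim Sel_∅^{w(E)}` is EVEN -/

section Frame

open Summit.BirchSwinnertonDyer.BirchSwinnertonDyer.Theses.AdditiveKolyvaginRoad
  Summit.BirchSwinnertonDyer.Rank1Residual.X11b Summit.BirchSwinnertonDyer.Rank1Residual.X11b.Three.Koly
  Literature.NumberTheory.EllipticCurves.ModularForms

variable (W : WeierstrassCurve ℚ) (K : Type) [Field K] [NumberField K] (p : ℕ) [W.IsElliptic] [W.IsGloballyMinimal]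
  [NeZero (W.conductorNorm ℤ)] [hp : Fact p.Prime] (c : K ≃ₐ[ℚ] K) [Module (ZMod p) (Vp W K p)]
  (Dt : ModularParametrizationData W (W.conductorNorm ℤ)) (β : ℤ) (ι : K →+* ℂ)

include Dt β ι in
/-- **AT A ♯ FRAME, FROM THE PUBLISHED INPUTS: `dim Sel_∅^{μ₀}` ODD and `dim Sel_∅^{¬μ₀}` EVEN, `μ₀ := (w(E/ℚ) = −1)`** — the
eigenspace of complex conjugation carrying the Heegner class `c(1) = δ(y_K)` (`kolyvaginClass_one_mem_selQP_empty`, sign `−w(E)`) has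
odd `𝔽_p`-dimension, the other one even. Frame: `p ≥ 5`, `ρ̄_{E,p}` onto, `r_an(E) = 1`, `K` imaginary quadratic with the Heegner
hypothesis for `N_E`, `L(E^{d_K}, 1) ≠ 0`, `4N ∣ β² − d_K`, `c ≠ 1`; granted `PublishedInputsAdditiveKoly` (Gross–Zagier `.1`,
Kolyvagin `.2.1`, modularity `.2.2.2.2.1`) and `PublishedDualityInputsAdditiveKoly` (`.1` = `casselsTate_levelInputs`). The Heegner point
`y_K` is non-torsion (GZ + modularity), `rank E(K) = 1` and `Ш(E/K)` finite (Kolyvagin), `c y_K = −w y_K` mod torsion (the proved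
reflection fact); then §2. Refines akr-p1's `oddSelmerRankAdditive_of_levelInputs` (total parity) and part 6's
`odd_finrank_selQP_empty_of_published`. CONDITIONAL on PUB ∕ DUAL; closes nothing. [cite: WZhang2014, Thm. 9.2, Thm. 11.2 (i)]
[cite: GrossLMS1991, Prop. 5.3, §10 (Prop. 2.3)] [cite: Darmon2004, Prop. 3.11] [cite: Kolyvagin1991MathAnn, §2 Thm. 4] -/
theorem odd_finrank_selQP_empty_sign_and_even_of_published (hPUB : PublishedInputsAdditiveKoly)
    (hDual : PublishedDualityInputsAdditiveKoly) (h5 : 5 ≤ p) (hsurj : W.HasSurjectiveModNGaloisRep p) (hr : W.analyticRank = 1)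
    (hK : IsImaginaryQuadratic K) (hH : SatisfiesHeegnerHypothesis (W.conductorNorm ℤ) K)
    (hL : (W.quadraticTwist (NumberField.discr K : ℚ)).entireLFunction 1 ≠ 0)
    (hβ : (4 * (W.conductorNorm ℤ : ℤ)) ∣ β ^ 2 - NumberField.discr K) (hc1 : c ≠ 1) :
    Odd (finrank (ZMod p) (SelQP W K p c ∅ (decide (W.rootNumber = -1)))) ∧
      Even (finrank (ZMod p) (SelQP W K p c ∅ (!decide (W.rootNumber = -1)))) := by
  have hpp : p.Prime := hp.out
  have hp2 : p ≠ 2 := by omega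
  have hcc : c * c = 1 := Method2.algEquiv_mul_self_eq_one K hK c
  have hirr : W.HasIrreducibleModPGaloisRep p := hasIrreducibleModPGaloisRep_of_hasSurjectiveModNGaloisRep W p hsurj
  -- THE Heegner point `P₀ = y_K ∈ E(K)` of the frame, non-torsion by Gross–Zagier + modularity
  obtain ⟨H, -⟩ := exists_heegnerDatum (W.conductorNorm ℤ) hK.discr_neg hβ
  obtain ⟨P₀, hP₀⟩ := heegnerPointComplex_mem_range_map_holds (W.conductorNorm ℤ) W K hK hH Dt H ι
  have hHP : IsHeegnerPoint (W.conductorNorm ℤ) W K P₀ := ⟨Dt, H, ι, hP₀⟩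
  have hPinf : ¬ IsOfFinAddOrder P₀ :=
    not_isOfFinAddOrder_of_heegner_of_analyticRank_eq_one W (W.conductorNorm ℤ) K Dt H ι P₀ (hPUB.1 _ W K) hPUB.2.2.2.2.1
      hr hK hH hL hP₀
  -- Kolyvagin: rank one and `Ш(E/K)` finite
  obtain ⟨hrank, hSha⟩ := hPUB.2.1 _ W K hK hH hHP hPinf
  -- the reflection fact: `c P₀ = −w(E) P₀` up to torsion
  have hσ : (c : K →ₐ[ℚ] K) ≠ AlgHom.id ℚ K := by
    intro h
    apply hc1
    apply AlgEquiv.ext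
    intro x
    exact DFunLike.congr_fun h x
  have htor := heegnerPoint_conj_add_rootNumber_smul_holds W K hK hH hHP (c : K →ₐ[ℚ] K) hσ
  have hP₀c : IsOfFinAddOrder (Affine.Point.map (W' := W) (c : K →ₐ[ℚ] K) P₀ - sgnP (decide (W.rootNumber = -1)) • P₀) := by
    rcases rootNumber_eq_one_or W with hw | hw
    · have hμ : decide (W.rootNumber = -1) = false := by rw [hw]; decide
      rw [hμ, show sgnP false = -1 from rfl, neg_one_zsmul, sub_neg_eq_add]
      rw [hw, one_zsmul] at htor
      exact htor
    · have hμ : decide (W.rootNumber = -1) = true := by rw [hw]; decide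
      rw [hμ, show sgnP true = 1 from rfl, one_zsmul]
      rw [hw, neg_one_zsmul, ← sub_eq_add_neg] at htor
      exact htor
  exact finrank_selQP_empty_odd_and_even W p c (hDual.1 K) hK hp2 hc1 hcc hirr hrank hSha _ hPinf hP₀c

end Frame

end Summit.BirchSwinnertonDyer.BirchSwinnertonDyer.Theorems.AdditiveKoly

end
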